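import Summits.NavierStokesRegularity.NavierStokesRegularity.Theorems.CorkscrewDynamoCorkscrewProfileRelativeEquilibriumConstraints
import Literature.Analysis.FluidPDE.PineauVicolRSSAlphaZero
import Literature.Analysis.FluidPDE.ChaeWolfRemovingDSSBounds

/-!
# Route CorkscrewDynamo · crux `CorkscrewProfile` (stmt-NavierStokesRegularity-11282) — rigidity of the birth-line stub

Line `birth` (`Cruxes/CorkscrewProfile/Lines/birth.lean`), lead c2. The line is closed modulo ONE stub,
`stub_relativeEquilibrium`: a smooth divergence-free solution `(V, Q)` on `ℝ³` of the steady backward Leray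
system in the frame rotating with angular velocity `ω` about `e₃`,

  `ω (e₃ × V − DV·(e₃ × y)) + ½ V + ½ (y·∇)V + (V·∇)V + ∇Q = ΔV`,  `div V = 0`,        (RE_ω)

inside the Type-I envelope `(1 + ‖y‖)‖V y‖ ≤ C`, `|Q y| ≤ C`, which is NOT invariant under the rotation
`R_{ωL}` for some `L > 0`. This file proves that every side clause of the stub is idle, so that the stub is
EXACTLY the existence problem for Type-I rotated self-similar profiles (Bradshaw–Tsai 2017 Open Problem
5.1, Tsai 2018 Conj. 8.9, Pineau–Vicol 2026 Conjecture 1.1 — negative side), in the very form in which the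
sibling route `FilamentSkeletonRss` reduces its target `RssProfileExists` (stmt-NavierStokesRegularity-16274)
to Perelman's rotated Leray profile system (`Theorems.stub_rssProfileExists_of_profile`):

* `relativeEquilibrium_eq_zero_of_omega_zero` — `ω = 0` carries no profile (Tsai 1998 = Pineau–Vicol
  Thm 1.4 at `α = 0`, tree theorem `pineauVicol2026_rss_liouville_alpha_zero`, through the frame dictionary);
* `rotGen_sub_fderiv_rotGen_eq_zero_of_equivariant`, `relativeEquilibrium_eq_zero_of_axisymmetric` — an
  axisymmetric profile has no rotation term (`J V − DV·J = d/dφ|₀ (R_φ V R_{−φ}) = 0`), hence solves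
  (RE_0), hence vanishes: the stub's non-invariance clause is automatic for nontrivial profiles
  (the barrier `AxisymmetricTypeIExclusion` as a theorem about the stub, without KNSS);
* `relativeEquilibrium_eq_zero_of_small` — an ABSOLUTE `ε₀ > 0` below which the envelope constant carries
  no profile, uniformly in `ω` (Chae–Wolf 2017, proof of Thm 1.3, Step 1, tree theorem
  `exists_eps_typeI_small_eq_zero`), complementing the `ω`-window of the Constraints file;
* `exists_pos_period_of_not_equivariant` — a non-axisymmetric profile at `α ≠ 0` violates invariance under
  `R_{αL}` for some `L > 0`;
* `relativeEquilibrium_iff_rotatedLerayProfile` — the EQUIVALENCE of the body of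
  `stub_relativeEquilibrium` with "`∃ α ≠ 0`, a smooth nontrivial divergence-free `(U, P)` solving
  `α(JU − DU[Jy]) + ½U + ½DU[y] − ΔU + DU[U] + ∇P = 0` with `‖U y‖ ≤ C₀/(1+‖y‖)` and `P` bounded"
  (`stub_relativeEquilibriumRigidity` = this ∧ the small-constant exclusion is the registered tools stub);
* consequences (sibling file `…RelativeEquilibriumBridges.lean`): the stub implies
  `FilamentSkeletonRss.RssProfileExists`, and one rotated Leray profile gives `CorkscrewProfile` — the two
  routes bet on ONE open object.
-/

noncomputable section

open Set Function MeasureTheory Literature.Analysis.FluidPDE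
open scoped InnerProductSpace

namespace Summit.NavierStokesRegularity.NavierStokesRegularity.Theorems.CorkscrewProfile.Birth

set_option linter.dupNamespace false

/-! ### The infinitesimal rotation term of an axisymmetric field -/

/-- Derivative of `ψ ↦ R_{−ψ} y`: `−J (R_{−φ} y)`. -/
theorem hasDerivAt_rotZ_neg_apply (y : EuclideanSpace ℝ (Fin 3)) (φ : ℝ) :
    HasDerivAt (fun ψ : ℝ => rotZ (-ψ) y) (-rotGen (rotZ (-φ) y)) φ := by
  have h := hasDerivAt_rotZ_comp (θ := fun ψ : ℝ => -ψ) (θ' := -1) (w := fun _ => y) (w' := 0)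
    (s := φ) (hasDerivAt_neg φ) (hasDerivAt_const φ y)
  convert h using 1
  have h0 : rotZ (-φ) (0 : EuclideanSpace ℝ (Fin 3)) = 0 := map_zero (rotZLIE (-φ))
  rw [h0, zero_add, neg_one_smul]

/-- **An axisymmetric field has no rotation term.** If `V` is differentiable and equivariant under
all rotations about `e₃`, `V (R_φ y) = R_φ (V y)`, then `J V(y) − DV(y)·(J y) = 0` (`J = e₃ × ·`):
differentiate the constant function `φ ↦ R_φ V(R_{−φ} y)` at `φ = 0`. -/
theorem rotGen_sub_fderiv_rotGen_eq_zero_of_equivariant {V : EuclideanSpace ℝ (Fin 3) → EuclideanSpace ℝ (Fin 3)}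
    (hV : Differentiable ℝ V) (hax : ∀ (φ : ℝ) (y : EuclideanSpace ℝ (Fin 3)), V (rotZ φ y) = rotZ φ (V y))
    (y : EuclideanSpace ℝ (Fin 3)) : rotGen (V y) - fderiv ℝ V y (rotGen y) = 0 := by
  -- the conjugated field is constant in `φ`
  have hconst : ∀ φ : ℝ, rotZ φ (V (rotZ (-φ) y)) = V y := by
    intro φ
    rw [hax, ← rotZ_add, add_neg_cancel, rotZ_zero]
  -- derivative of `φ ↦ V (R_{−φ} y)` at `0`
  have hw : HasDerivAt (fun φ : ℝ => V (rotZ (-φ) y)) (fderiv ℝ V y (-rotGen y)) 0 := by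
    have h3 := (hV (rotZ (-0) y)).hasFDerivAt.comp_hasDerivAt (0 : ℝ) (hasDerivAt_rotZ_neg_apply y 0)
    simp only [neg_zero, rotZ_zero] at h3
    exact h3
  have h := hasDerivAt_rotZ_comp (θ := fun φ : ℝ => φ) (θ' := 1) (hasDerivAt_id (0 : ℝ)) hw
  have hc : HasDerivAt (fun φ : ℝ => rotZ φ (V (rotZ (-φ) y))) 0 0 := by
    have e : (fun φ : ℝ => rotZ φ (V (rotZ (-φ) y))) = fun _ => V y := funext hconst
    rw [e]
    exact hasDerivAt_const 0 (V y)
  have heq := h.unique hc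
  simp only [neg_zero, rotZ_zero, one_smul, map_neg, neg_add_eq_sub] at heq
  exact heq

/-! ### Three exclusions: `ω = 0`, axisymmetric profiles, small envelope constants -/

/-- **No relative equilibrium at `ω = 0`** (Tsai 1998 = Pineau–Vicol 2026 Thm 1.4 at `α = 0`, tree
theorem `pineauVicol2026_rss_liouville_alpha_zero`, through the co-rotating frame dictionary
`rotatingWave_isClassical_typeI_pvAnsatz`): a smooth divergence-free solution `(V, Q)` of (RE_0) — Leray's
own profile equation — in the envelope `(1 + ‖y‖)‖V y‖ ≤ C` vanishes. No threshold, no pressure bound. -/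
theorem relativeEquilibrium_eq_zero_of_omega_zero
    (Rot : ℝ → (EuclideanSpace ℝ (Fin 3) ≃ₗᵢ[ℝ] EuclideanSpace ℝ (Fin 3)))
    (V : EuclideanSpace ℝ (Fin 3) → EuclideanSpace ℝ (Fin 3)) (Q : EuclideanSpace ℝ (Fin 3) → ℝ) {C : ℝ}
    (hRot : ∀ (φ : ℝ) (x : EuclideanSpace ℝ (Fin 3)),
        Rot φ x 0 = Real.cos φ * x 0 - Real.sin φ * x 1 ∧
        Rot φ x 1 = Real.sin φ * x 0 + Real.cos φ * x 1 ∧ Rot φ x 2 = x 2)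
    (hV : ContDiff ℝ (⊤ : ℕ∞) V) (hQ : ContDiff ℝ (⊤ : ℕ∞) Q)
    (hdiv : Literature.Analysis.FluidPDE.VectorCalculus.IsDivFree V)
    (hEq : ∀ y : EuclideanSpace ℝ (Fin 3),
        (0 : ℝ) • (cross (EuclideanSpace.single (2 : Fin 3) (1 : ℝ)) (V y)
              - fderiv ℝ V y (cross (EuclideanSpace.single (2 : Fin 3) (1 : ℝ)) y))
          + (1 / 2 : ℝ) • V y + (1 / 2 : ℝ) • fderiv ℝ V y y + convect V V y + gradient Q y
          = Laplacian.laplacian V y)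
    (hVb : ∀ y : EuclideanSpace ℝ (Fin 3), (1 + ‖y‖) * ‖V y‖ ≤ C) : V = 0 := by
  obtain ⟨hcl, hI, hans⟩ := rotatingWave_isClassical_typeI_pvAnsatz Rot 0 V Q hRot hV hQ hdiv hEq hVb
  exact pineauVicol2026_rss_liouville_alpha_zero C _ _ V hcl hI hans

/-- **No axisymmetric relative equilibrium, at any `ω`.** A smooth divergence-free solution `(V, Q)` of
(RE_ω) in the envelope which is equivariant under all the rotations about `e₃` (`V (R_φ y) = R_φ (V y)`)
vanishes: its rotation term `J V − DV·J` is zero (`rotGen_sub_fderiv_rotGen_eq_zero_of_equivariant`), so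
it solves (RE_0). This is the typed reason why the stub's non-invariance clause costs nothing. -/
theorem relativeEquilibrium_eq_zero_of_axisymmetric
    (Rot : ℝ → (EuclideanSpace ℝ (Fin 3) ≃ₗᵢ[ℝ] EuclideanSpace ℝ (Fin 3))) (ω : ℝ)
    (V : EuclideanSpace ℝ (Fin 3) → EuclideanSpace ℝ (Fin 3)) (Q : EuclideanSpace ℝ (Fin 3) → ℝ) {C : ℝ}
    (hRot : ∀ (φ : ℝ) (x : EuclideanSpace ℝ (Fin 3)),
        Rot φ x 0 = Real.cos φ * x 0 - Real.sin φ * x 1 ∧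
        Rot φ x 1 = Real.sin φ * x 0 + Real.cos φ * x 1 ∧ Rot φ x 2 = x 2)
    (hV : ContDiff ℝ (⊤ : ℕ∞) V) (hQ : ContDiff ℝ (⊤ : ℕ∞) Q)
    (hdiv : Literature.Analysis.FluidPDE.VectorCalculus.IsDivFree V)
    (hEq : ∀ y : EuclideanSpace ℝ (Fin 3),
        ω • (cross (EuclideanSpace.single (2 : Fin 3) (1 : ℝ)) (V y)
              - fderiv ℝ V y (cross (EuclideanSpace.single (2 : Fin 3) (1 : ℝ)) y))
          + (1 / 2 : ℝ) • V y + (1 / 2 : ℝ) • fderiv ℝ V y y + convect V V y + gradient Q y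
          = Laplacian.laplacian V y)
    (hVb : ∀ y : EuclideanSpace ℝ (Fin 3), (1 + ‖y‖) * ‖V y‖ ≤ C)
    (hax : ∀ (φ : ℝ) (y : EuclideanSpace ℝ (Fin 3)), V (Rot φ y) = Rot φ (V y)) : V = 0 := by
  have hax' : ∀ (φ : ℝ) (y : EuclideanSpace ℝ (Fin 3)), V (rotZ φ y) = rotZ φ (V y) := by
    intro φ y
    rw [← rot_eq_rotZ Rot hRot, ← rot_eq_rotZ Rot hRot, hax]
  have hdiff : Differentiable ℝ V := hV.differentiable (by simp)
  have hrot : ∀ y : EuclideanSpace ℝ (Fin 3),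
      cross (EuclideanSpace.single (2 : Fin 3) (1 : ℝ)) (V y)
        - fderiv ℝ V y (cross (EuclideanSpace.single (2 : Fin 3) (1 : ℝ)) y) = 0 := by
    intro y
    rw [cross_single_two_eq_rotGen, cross_single_two_eq_rotGen]
    exact rotGen_sub_fderiv_rotGen_eq_zero_of_equivariant hdiff hax' y
  refine relativeEquilibrium_eq_zero_of_omega_zero Rot V Q hRot hV hQ hdiv (fun y => ?_) hVb
  have h := hEq y
  rw [hrot y, smul_zero] at h
  rw [hrot y, smul_zero]
  exact h

/-- **Small envelope constants carry no relative equilibrium, uniformly in `ω`** (Chae–Wolf 2017,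
proof of Thm 1.3, Step 1, tree theorem `exists_eps_typeI_small_eq_zero`: Type-I ancient classical
solutions with `√(−t)‖u‖ ≤ ε₀` vanish). There is an absolute `ε₀ > 0` such that every smooth
divergence-free solution `(V, Q)` of (RE_ω), any `ω`, with `(1 + ‖y‖)‖V y‖ ≤ C` and `C ≤ ε₀` vanishes:
the rotating wave `u` has `√(−t)‖u(t,x)‖ = ‖V(·)‖ ≤ C`. So a corkscrew constructor must work at
`C > ε₀` (and then inside the `ω`-window of `relativeEquilibrium_rotation_window`). -/
theorem relativeEquilibrium_eq_zero_of_small :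
    ∃ ε₀ : ℝ, 0 < ε₀ ∧
      ∀ (Rot : ℝ → (EuclideanSpace ℝ (Fin 3) ≃ₗᵢ[ℝ] EuclideanSpace ℝ (Fin 3))) (ω C : ℝ)
        (V : EuclideanSpace ℝ (Fin 3) → EuclideanSpace ℝ (Fin 3)) (Q : EuclideanSpace ℝ (Fin 3) → ℝ),
        (∀ (φ : ℝ) (x : EuclideanSpace ℝ (Fin 3)),
            Rot φ x 0 = Real.cos φ * x 0 - Real.sin φ * x 1 ∧
            Rot φ x 1 = Real.sin φ * x 0 + Real.cos φ * x 1 ∧ Rot φ x 2 = x 2) →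
        ContDiff ℝ (⊤ : ℕ∞) V → ContDiff ℝ (⊤ : ℕ∞) Q →
        Literature.Analysis.FluidPDE.VectorCalculus.IsDivFree V →
        (∀ y : EuclideanSpace ℝ (Fin 3),
            ω • (Literature.Analysis.FluidPDE.cross (EuclideanSpace.single (2 : Fin 3) (1 : ℝ)) (V y)
                  - fderiv ℝ V y (Literature.Analysis.FluidPDE.cross (EuclideanSpace.single (2 : Fin 3) (1 : ℝ)) y))
              + (1 / 2 : ℝ) • V y + (1 / 2 : ℝ) • fderiv ℝ V y y
              + Literature.Analysis.FluidPDE.convect V V y + gradient Q y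
              = Laplacian.laplacian V y) →
        (∀ y : EuclideanSpace ℝ (Fin 3), (1 + ‖y‖) * ‖V y‖ ≤ C) →
        C ≤ ε₀ → V = 0 := by
  obtain ⟨ε₀, hε₀, H⟩ := ChaeWolf.exists_eps_typeI_small_eq_zero
  refine ⟨ε₀, hε₀, fun Rot ω C V Q hRot hV hQ hdiv hEq hVb hC => ?_⟩
  set U : ℝ → EuclideanSpace ℝ (Fin 3) → EuclideanSpace ℝ (Fin 3) :=
    fun s y => Rot (ω * s) (V (Rot (-(ω * s)) y)) with hU
  have hBL := stub_corotatingFrame Rot ω V Q hRot hV hQ hdiv hEq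
  have hcl : IsClassicalNSSolutionOn (Iio 0) 1 0 (ofLerayOrbit U)
      (ofLerayOrbitPressure fun s y => Q (Rot (-(ω * s)) y)) :=
    isClassicalNSSolutionOn_Iio_ofLerayOrbit_iff.2 hBL
  have hVle : ∀ y : EuclideanSpace ℝ (Fin 3), ‖V y‖ ≤ C := fun y => by
    have h := hVb y
    nlinarith [norm_nonneg y, norm_nonneg (V y)]
  have hC0 : 0 ≤ C := (norm_nonneg _).trans (hVle 0)
  have hTI : HasTypeIDecay C (ofLerayOrbit U) := by
    refine hasTypeIDecay_iff_lerayOrbit.2 fun s y => ?_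
    rw [lerayOrbit_ofLerayOrbit]
    simp only [hU]
    rw [LinearIsometryEquiv.norm_map]
    have key := hVb (Rot (-(ω * s)) y)
    rwa [LinearIsometryEquiv.norm_map] at key
  have hsmall : ∀ t < 0, ∀ x : EuclideanSpace ℝ (Fin 3), √(-t) * ‖ofLerayOrbit U t x‖ ≤ ε₀ := by
    intro t ht x
    have hs : 0 < √(-t) := Real.sqrt_pos.2 (by linarith)
    rw [ofLerayOrbit_apply, norm_smul, norm_inv, Real.norm_of_nonneg hs.le, ← mul_assoc,
      mul_inv_cancel₀ hs.ne', one_mul]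
    simp only [hU]
    rw [LinearIsometryEquiv.norm_map]
    exact (hVle _).trans hC
  have hzero := H hC0 hcl hTI hsmall
  funext x
  have hx := hzero (-1) (by norm_num) x
  simp only [ofLerayOrbit_apply, hU, neg_neg, Real.sqrt_one, inv_one, one_smul, Real.log_one, neg_zero,
    mul_zero, rot_zero_apply Rot hRot] at hx
  simpa using hx

/-! ### From non-axisymmetry to the stub's non-invariance clause -/

/-- `rotZLIE` is a rotation family about `e₃` pinned by coordinates. -/
theorem rotZLIE_pinned (φ : ℝ) (x : EuclideanSpace ℝ (Fin 3)) :
    rotZLIE φ x 0 = Real.cos φ * x 0 - Real.sin φ * x 1 ∧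
      rotZLIE φ x 1 = Real.sin φ * x 0 + Real.cos φ * x 1 ∧ rotZLIE φ x 2 = x 2 := by
  simp

/-- **A non-axisymmetric pattern turning at rate `α ≠ 0` moves.** If `U` is not equivariant under some
rotation about `e₃`, then for some period `L > 0` the profile is not invariant under `R_{αL}`:
`∃ y, R_{αL} U(R_{−αL} y) ≠ U y`. (Non-equivariance under `R_φ` at `y` is non-equivariance under
`R_{−φ}` at `R_φ y`, so the sign of `φ/α` can be chosen.) -/
theorem exists_pos_period_of_not_equivariant {α : ℝ} (hα : α ≠ 0)
    {U : EuclideanSpace ℝ (Fin 3) → EuclideanSpace ℝ (Fin 3)}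
    (h : ∃ (φ : ℝ) (y : EuclideanSpace ℝ (Fin 3)), U (rotZ φ y) ≠ rotZ φ (U y)) :
    ∃ L : ℝ, 0 < L ∧ ∃ y : EuclideanSpace ℝ (Fin 3), rotZLIE (α * L) (U (rotZLIE (-(α * L)) y)) ≠ U y := by
  obtain ⟨φ, y, hy⟩ := h
  -- the clause at angle `ψ` from non-equivariance under `R_ψ` at `z`, at the point `R_ψ z`
  have clause : ∀ (ψ : ℝ) (z : EuclideanSpace ℝ (Fin 3)), U (rotZ ψ z) ≠ rotZ ψ (U z) →
      ∃ y : EuclideanSpace ℝ (Fin 3), rotZLIE ψ (U (rotZLIE (-ψ) y)) ≠ U y := by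
    intro ψ z hz
    refine ⟨rotZ ψ z, ?_⟩
    rw [rotZLIE_apply, rotZLIE_apply, ← rotZ_add, neg_add_cancel, rotZ_zero]
    exact fun h' => hz h'.symm
  -- non-equivariance under `R_{−φ}` at `R_φ y`
  have hy' : U (rotZ (-φ) (rotZ φ y)) ≠ rotZ (-φ) (U (rotZ φ y)) := by
    rw [← rotZ_add, neg_add_cancel, rotZ_zero]
    intro h'
    apply hy
    rw [h', ← rotZ_add, add_neg_cancel, rotZ_zero]
  have hφ : φ ≠ 0 := by
    rintro rfl
    rw [rotZ_zero, rotZ_zero] at hy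
    exact hy rfl
  by_cases hs : 0 < φ / α
  · refine ⟨φ / α, hs, ?_⟩
    have e : α * (φ / α) = φ := by field_simp
    rw [e]
    exact clause φ y hy
  · have hne : φ / α ≠ 0 := div_ne_zero hφ hα
    have hlt : φ / α < 0 := lt_of_le_of_ne (not_lt.1 hs) hne
    refine ⟨-φ / α, by rw [neg_div]; linarith, ?_⟩
    have e : α * (-φ / α) = -φ := by field_simp
    rw [e]
    exact clause (-φ) (rotZ φ y) hy'

/-! ### The equivalence with the rotated Leray profile system -/

/-- **The birth-line stub IS the existence of a Type-I rotated self-similar profile.** The body of `stub_relativeEquilibrium` (a non-`R_{ωL}`-invariant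
smooth divergence-free solution `(V, Q)` of (RE_ω) in the Type-I envelope with bounded pressure, `L > 0`)
is equivalent to the existence of `α ≠ 0` and a smooth NONTRIVIAL divergence-free solution `(U, P)` of
Perelman's rotated Leray profile system `α(JU − DU[Jy]) + ½U + ½DU[y] − ΔU + DU[U] + ∇P = 0`
(Pineau–Vicol 2026, (1.8)) with `‖U y‖ ≤ C₀/(1+‖y‖)` and `P` bounded — verbatim the hypothesis of
`Theorems.stub_rssProfileExists_of_profile` (route `FilamentSkeletonRss`). `→`: `ω ≠ 0` by
`relativeEquilibrium_eq_zero_of_omega_zero`, `V ≠ 0` from non-invariance, `e₃ × · = J`. `←`: one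
constant `max C₀ M`; non-invariance for some `L > 0` because an axisymmetric profile would vanish
(`relativeEquilibrium_eq_zero_of_axisymmetric`, `exists_pos_period_of_not_equivariant`). -/
theorem relativeEquilibrium_iff_rotatedLerayProfile :
    (∃ (Rot : ℝ → (EuclideanSpace ℝ (Fin 3) ≃ₗᵢ[ℝ] EuclideanSpace ℝ (Fin 3))) (ω L C : ℝ)
      (V : EuclideanSpace ℝ (Fin 3) → EuclideanSpace ℝ (Fin 3)) (Q : EuclideanSpace ℝ (Fin 3) → ℝ),
      (∀ (φ : ℝ) (x : EuclideanSpace ℝ (Fin 3)),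
          Rot φ x 0 = Real.cos φ * x 0 - Real.sin φ * x 1 ∧
          Rot φ x 1 = Real.sin φ * x 0 + Real.cos φ * x 1 ∧ Rot φ x 2 = x 2) ∧
      0 < L ∧ ContDiff ℝ (⊤ : ℕ∞) V ∧ ContDiff ℝ (⊤ : ℕ∞) Q ∧
      Literature.Analysis.FluidPDE.VectorCalculus.IsDivFree V ∧
      (∀ y : EuclideanSpace ℝ (Fin 3),
          ω • (Literature.Analysis.FluidPDE.cross (EuclideanSpace.single (2 : Fin 3) (1 : ℝ)) (V y)
                - fderiv ℝ V y (Literature.Analysis.FluidPDE.cross (EuclideanSpace.single (2 : Fin 3) (1 : ℝ)) y))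
            + (1 / 2 : ℝ) • V y + (1 / 2 : ℝ) • fderiv ℝ V y y
            + Literature.Analysis.FluidPDE.convect V V y + gradient Q y
            = Laplacian.laplacian V y) ∧
      (∀ y : EuclideanSpace ℝ (Fin 3), (1 + ‖y‖) * ‖V y‖ ≤ C) ∧
      (∀ y : EuclideanSpace ℝ (Fin 3), |Q y| ≤ C) ∧
      (∃ y : EuclideanSpace ℝ (Fin 3), Rot (ω * L) (V (Rot (-(ω * L)) y)) ≠ V y)) ↔
    (∃ (α C₀ M : ℝ) (U : EuclideanSpace ℝ (Fin 3) → EuclideanSpace ℝ (Fin 3))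
      (P : EuclideanSpace ℝ (Fin 3) → ℝ), α ≠ 0 ∧ U ≠ 0 ∧ ContDiff ℝ (⊤ : ℕ∞) U ∧ ContDiff ℝ (⊤ : ℕ∞) P ∧
      Literature.Analysis.FluidPDE.VectorCalculus.IsDivFree U ∧
      (∀ y : EuclideanSpace ℝ (Fin 3),
        α • (Literature.Analysis.FluidPDE.rotGen (U y) - fderiv ℝ U y (Literature.Analysis.FluidPDE.rotGen y))
          + (1 / 2 : ℝ) • U y + (1 / 2 : ℝ) • fderiv ℝ U y y - Laplacian.laplacian U y
          + fderiv ℝ U y (U y) + gradient P y = 0) ∧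
      (∀ y : EuclideanSpace ℝ (Fin 3), ‖U y‖ ≤ C₀ / (1 + ‖y‖)) ∧
      (∀ y : EuclideanSpace ℝ (Fin 3), |P y| ≤ M)) := by
  constructor
  · rintro ⟨Rot, ω, L, C, V, Q, hRot, -, hV, hQ, hdiv, hEq, hVb, hQb, y₀, hy₀⟩
    have hV0 : V ≠ 0 := by
      rintro rfl
      exact hy₀ (by simp)
    have hω : ω ≠ 0 := by
      rintro rfl
      exact hV0 (relativeEquilibrium_eq_zero_of_omega_zero Rot V Q hRot hV hQ hdiv hEq hVb)
    refine ⟨ω, C, C, V, Q, hω, hV0, hV, hQ, hdiv, fun y => ?_, fun y => ?_, hQb⟩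
    · have h := hEq y
      rw [cross_single_two_eq_rotGen, cross_single_two_eq_rotGen] at h
      simp only [convect] at h
      rw [← h]
      abel
    · rw [add_comm]
      exact profile_bound_of_envelope hVb y
  · rintro ⟨α, C₀, M, U, P, hα, hU0, hU, hP, hdiv, hEq, hUb, hPM⟩
    have hUb' : ∀ y : EuclideanSpace ℝ (Fin 3), (1 + ‖y‖) * ‖U y‖ ≤ max C₀ M := fun y => by
      have h := hUb y
      rw [le_div_iff₀ (by positivity)] at h
      calc (1 + ‖y‖) * ‖U y‖ = ‖U y‖ * (1 + ‖y‖) := mul_comm _ _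
        _ ≤ C₀ := h
        _ ≤ max C₀ M := le_max_left _ _
    have hPM' : ∀ y : EuclideanSpace ℝ (Fin 3), |P y| ≤ max C₀ M := fun y => (hPM y).trans (le_max_right _ _)
    have hEq' : ∀ y : EuclideanSpace ℝ (Fin 3),
        α • (cross (EuclideanSpace.single (2 : Fin 3) (1 : ℝ)) (U y)
              - fderiv ℝ U y (cross (EuclideanSpace.single (2 : Fin 3) (1 : ℝ)) y))
          + (1 / 2 : ℝ) • U y + (1 / 2 : ℝ) • fderiv ℝ U y y + convect U U y + gradient P y
          = Laplacian.laplacian U y := by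
      intro y
      have h := hEq y
      rw [cross_single_two_eq_rotGen, cross_single_two_eq_rotGen]
      simp only [convect]
      rw [← sub_eq_zero, ← h]
      abel
    have hnax : ∃ (φ : ℝ) (y : EuclideanSpace ℝ (Fin 3)), U (rotZ φ y) ≠ rotZ φ (U y) := by
      by_contra hcon
      push Not at hcon
      apply hU0
      refine relativeEquilibrium_eq_zero_of_axisymmetric rotZLIE α U P rotZLIE_pinned hU hP hdiv hEq' hUb' ?_
      intro φ y
      rw [rotZLIE_apply, rotZLIE_apply]
      exact hcon φ y
    obtain ⟨L, hL, hy⟩ := exists_pos_period_of_not_equivariant hα hnax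
    exact ⟨rotZLIE, α, L, max C₀ M, U, P, rotZLIE_pinned, hL, hU, hP, hdiv, hEq', hUb', hPM', hy⟩

/-! ### The registered tools stub -/

/-- **Registered tools stub `stub_relativeEquilibriumRigidity` of the line `birth`** (crux
stmt-NavierStokesRegularity-11282): the conjunction of the rigidity equivalence
`relativeEquilibrium_iff_rotatedLerayProfile` (the body of `stub_relativeEquilibrium` ↔ a smooth nontrivial
solution of Perelman's rotated Leray profile system with `α ≠ 0`, Type-I profile decay and bounded pressure)
and the uniform small-constant exclusion `relativeEquilibrium_eq_zero_of_small` (an absolute `ε₀ > 0` below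
which the envelope constant carries no relative equilibrium, at any `ω`). -/
theorem stub_relativeEquilibriumRigidity :
    ((∃ (Rot : ℝ → (EuclideanSpace ℝ (Fin 3) ≃ₗᵢ[ℝ] EuclideanSpace ℝ (Fin 3))) (ω L C : ℝ)
      (V : EuclideanSpace ℝ (Fin 3) → EuclideanSpace ℝ (Fin 3)) (Q : EuclideanSpace ℝ (Fin 3) → ℝ),
      (∀ (φ : ℝ) (x : EuclideanSpace ℝ (Fin 3)),
          Rot φ x 0 = Real.cos φ * x 0 - Real.sin φ * x 1 ∧
          Rot φ x 1 = Real.sin φ * x 0 + Real.cos φ * x 1 ∧ Rot φ x 2 = x 2) ∧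
      0 < L ∧ ContDiff ℝ (⊤ : ℕ∞) V ∧ ContDiff ℝ (⊤ : ℕ∞) Q ∧
      Literature.Analysis.FluidPDE.VectorCalculus.IsDivFree V ∧
      (∀ y : EuclideanSpace ℝ (Fin 3),
          ω • (Literature.Analysis.FluidPDE.cross (EuclideanSpace.single (2 : Fin 3) (1 : ℝ)) (V y)
                - fderiv ℝ V y (Literature.Analysis.FluidPDE.cross (EuclideanSpace.single (2 : Fin 3) (1 : ℝ)) y))
            + (1 / 2 : ℝ) • V y + (1 / 2 : ℝ) • fderiv ℝ V y y
            + Literature.Analysis.FluidPDE.convect V V y + gradient Q y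
            = Laplacian.laplacian V y) ∧
      (∀ y : EuclideanSpace ℝ (Fin 3), (1 + ‖y‖) * ‖V y‖ ≤ C) ∧
      (∀ y : EuclideanSpace ℝ (Fin 3), |Q y| ≤ C) ∧
      (∃ y : EuclideanSpace ℝ (Fin 3), Rot (ω * L) (V (Rot (-(ω * L)) y)) ≠ V y)) ↔
    (∃ (α C₀ M : ℝ) (U : EuclideanSpace ℝ (Fin 3) → EuclideanSpace ℝ (Fin 3))
      (P : EuclideanSpace ℝ (Fin 3) → ℝ), α ≠ 0 ∧ U ≠ 0 ∧ ContDiff ℝ (⊤ : ℕ∞) U ∧ ContDiff ℝ (⊤ : ℕ∞) P ∧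
      Literature.Analysis.FluidPDE.VectorCalculus.IsDivFree U ∧
      (∀ y : EuclideanSpace ℝ (Fin 3),
        α • (Literature.Analysis.FluidPDE.rotGen (U y) - fderiv ℝ U y (Literature.Analysis.FluidPDE.rotGen y))
          + (1 / 2 : ℝ) • U y + (1 / 2 : ℝ) • fderiv ℝ U y y - Laplacian.laplacian U y
          + fderiv ℝ U y (U y) + gradient P y = 0) ∧
      (∀ y : EuclideanSpace ℝ (Fin 3), ‖U y‖ ≤ C₀ / (1 + ‖y‖)) ∧
      (∀ y : EuclideanSpace ℝ (Fin 3), |P y| ≤ M))) ∧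
    (∃ ε₀ : ℝ, 0 < ε₀ ∧
      ∀ (Rot : ℝ → (EuclideanSpace ℝ (Fin 3) ≃ₗᵢ[ℝ] EuclideanSpace ℝ (Fin 3))) (ω C : ℝ)
        (V : EuclideanSpace ℝ (Fin 3) → EuclideanSpace ℝ (Fin 3)) (Q : EuclideanSpace ℝ (Fin 3) → ℝ),
        (∀ (φ : ℝ) (x : EuclideanSpace ℝ (Fin 3)),
            Rot φ x 0 = Real.cos φ * x 0 - Real.sin φ * x 1 ∧
            Rot φ x 1 = Real.sin φ * x 0 + Real.cos φ * x 1 ∧ Rot φ x 2 = x 2) →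
        ContDiff ℝ (⊤ : ℕ∞) V → ContDiff ℝ (⊤ : ℕ∞) Q →
        Literature.Analysis.FluidPDE.VectorCalculus.IsDivFree V →
        (∀ y : EuclideanSpace ℝ (Fin 3),
            ω • (Literature.Analysis.FluidPDE.cross (EuclideanSpace.single (2 : Fin 3) (1 : ℝ)) (V y)
                  - fderiv ℝ V y (Literature.Analysis.FluidPDE.cross (EuclideanSpace.single (2 : Fin 3) (1 : ℝ)) y))
              + (1 / 2 : ℝ) • V y + (1 / 2 : ℝ) • fderiv ℝ V y y
              + Literature.Analysis.FluidPDE.convect V V y + gradient Q y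
              = Laplacian.laplacian V y) →
        (∀ y : EuclideanSpace ℝ (Fin 3), (1 + ‖y‖) * ‖V y‖ ≤ C) →
        C ≤ ε₀ → V = 0) :=
  ⟨relativeEquilibrium_iff_rotatedLerayProfile, relativeEquilibrium_eq_zero_of_small⟩

end Summit.NavierStokesRegularity.NavierStokesRegularity.Theorems.CorkscrewProfile.Birth
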